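import Summits.ResolutionOfSingularities.ResolutionOfSingularities.Theorems.FrobeniusClosingClosingReductionArenaDefs

/-!
# Stub `stub_arena` of crux `ClosingReduction` (line `chart-factorization`), part 2 of 3:
# functoriality and jet locality of the calculus, universality of `Phi`, jet codes

Crux `stmt-ResolutionOfSingularities-16347`; definitions in `Theorems/FrobeniusClosingDefs.lean` and
in part 1 (`…ArenaDefs.lean`). Helper sub-namespace `ArenaProof`. Proofs only.

* § 6 `comp_succR` — the calculus commutes with ring homomorphisms applied coefficientwise
  (`map_sum`/`map_prod`/`map_natCast`);
* § 7 `succR_congr`, `succR_congr_of_le` — JET LOCALITY: the coefficient of `u^B` of a successor only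
  reads the cleaned coefficients of the predecessor in total degree `B i + p` (the blow-up chart
  reads one total degree), hence states agreeing in degrees `≤ E + p` have successors agreeing in
  degrees `≤ E`;
* § 8 `aeval_Phi` — UNIVERSALITY: the value of `Phi j s` at an edge `(v, v')` is the coefficient at
  `e s` of the successor (chart `j`, translation read off `v`) of the buffered state recorded in `v`;
  `forall_Psys_iff`, `exists_Qsys_iff` — what the system says about an edge;
* § 9 — `decode`/`code`/`stateR` bookkeeping over a field (`code_decode` = the anchor
  `arena_code_decode`, `multP_decode`, `multP_stateR`, `stateR_eq_decode`).
-/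

noncomputable section

-- single-problem summit: the doubled namespace component `ResolutionOfSingularities` is forced
set_option linter.dupNamespace false

open scoped BigOperators Classical

namespace Summit.ResolutionOfSingularities.ResolutionOfSingularities.Theorems.FrobeniusClosing

namespace ArenaProof

/-! ## 6. The calculus commutes with ring homomorphisms (applied coefficientwise) -/

section Hom

variable {p n : ℕ} {R S : Type} [CommRing R] [CommRing S]
variable {F : Type} [FunLike F R S] [RingHomClass F R S] (f : F)

/-- `cleanR` commutes with ring homomorphisms. [folklore] -/
theorem comp_cleanR (c : (Fin n → ℕ) → R) : f ∘ cleanR p n R c = cleanR p n S (f ∘ c) := by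
  funext A
  simp only [Function.comp_apply, cleanR]
  split_ifs
  · exact map_zero f
  · rfl

/-- `blR` commutes with ring homomorphisms. [folklore] -/
theorem comp_blR (i : Fin n) (c : (Fin n → ℕ) → R) : f ∘ blR n R i c = blR n S i (f ∘ c) := by
  funext B
  simp only [Function.comp_apply, blR]
  split_ifs
  · rfl
  · exact map_zero f

omit [CommRing R] [CommRing S] [RingHomClass F R S] in
/-- `dvR` commutes with ring homomorphisms (with every map, in fact). [folklore] -/
theorem comp_dvR (i : Fin n) (s : ℕ) (c : (Fin n → ℕ) → R) :
    f ∘ dvR n R i s c = dvR n S i s (f ∘ c) := rfl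

/-- `trR` commutes with ring homomorphisms. [folklore] -/
theorem comp_trR (i : Fin n) (τ : Fin n → R) (s : ℕ) (c : (Fin n → ℕ) → R) :
    f ∘ trR n R i τ s c = trR n S i (f ∘ τ) s (f ∘ c) := by
  funext B
  simp only [Function.comp_apply, trR, map_sum]
  refine Finset.sum_congr rfl (fun D _ => ?_)
  split_ifs
  · simp only [map_mul, map_prod, map_natCast, map_pow]
  · exact map_zero f

/-- `succR` commutes with ring homomorphisms. [folklore] -/
theorem comp_succR (i : Fin n) (τ : Fin n → R) (c : (Fin n → ℕ) → R) :
    f ∘ succR p n R i τ c = succR p n S i (f ∘ τ) (f ∘ c) := by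
  unfold succR
  rw [comp_cleanR, comp_trR, comp_dvR, comp_blR, comp_cleanR]

/-- `stateR` commutes with ring homomorphisms. [folklore] -/
theorem comp_stateR {N N₂ : ℕ} (e : Fin N → (Fin n → ℕ)) (e₂ : Fin N₂ → (Fin n → ℕ))
    (x : Fin N → R) (z : Fin N₂ → R) :
    f ∘ stateR n R e e₂ x z = stateR n S e e₂ (f ∘ x) (f ∘ z) := by
  funext A
  simp only [Function.comp_apply, stateR]
  split_ifs
  · rfl
  · rfl
  · exact map_zero f

end Hom

/-! ## 7. Jet locality: the blow-up chart reads the state in ONE total degree -/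

section Locality

variable {p n : ℕ} {R : Type} [CommRing R]

/-- The total degree of the exponent read by `bl` after `dv`: if `Σ_{j ≠ i} B' j ≤ B' i` then the
updated exponent has total degree `B' i`. [folklore] -/
theorem sum_update_sub (i : Fin n) (B' : Fin n → ℕ)
    (hle : Finset.sum (Finset.univ.erase i) (fun j => B' j) ≤ B' i) :
    Finset.sum Finset.univ
        (fun j => Function.update B' i (B' i - Finset.sum (Finset.univ.erase i) (fun j => B' j)) j) =
      B' i := by
  rw [Finset.sum_update_of_mem (Finset.mem_univ i), Finset.sdiff_singleton_eq_erase]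
  omega

/-- JET LOCALITY of the chart move: `trR i τ s (dvR i s (blR i c)) B` only depends on the values of
`c` in total degree exactly `B i + s`. [folklore] -/
theorem trR_dvR_blR_congr (i : Fin n) (τ : Fin n → R) (s : ℕ) {c c' : (Fin n → ℕ) → R}
    (B : Fin n → ℕ)
    (h : ∀ A : Fin n → ℕ, Finset.sum Finset.univ (fun j => A j) = B i + s → c A = c' A) :
    trR n R i τ s (dvR n R i s (blR n R i c)) B = trR n R i τ s (dvR n R i s (blR n R i c')) B := by
  simp only [trR, dvR, blR]
  refine Finset.sum_congr rfl (fun D _ => ?_)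
  by_cases hDi : D i = 0
  · rw [if_pos hDi, if_pos hDi]
    split_ifs with hle
    · rw [h _ ?_]
      rw [sum_update_sub i _ hle, Function.update_self, Pi.add_apply, hDi]
      ring
    · rfl
  · rw [if_neg hDi, if_neg hDi]

/-- `cleanR c B` only depends on `c B`. [folklore] -/
theorem cleanR_congr_at {c c' : (Fin n → ℕ) → R} (B : Fin n → ℕ) (h : c B = c' B) :
    cleanR p n R c B = cleanR p n R c' B := by
  unfold cleanR
  rw [h]

/-- JET LOCALITY of the successor operator: `succR i τ c B` only depends on the cleaned
coefficients of `c` in total degree `B i + p`. [folklore] -/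
theorem succR_congr (i : Fin n) (τ : Fin n → R) {c c' : (Fin n → ℕ) → R} (B : Fin n → ℕ)
    (h : ∀ A : Fin n → ℕ, Finset.sum Finset.univ (fun j => A j) = B i + p →
      cleanR p n R c A = cleanR p n R c' A) :
    succR p n R i τ c B = succR p n R i τ c' B :=
  cleanR_congr_at B (trR_dvR_blR_congr i τ p B h)

/-- JET LOCALITY, degree-bounded form: states with the same cleaned coefficients in all total
degrees `≤ E + p` have the same successors in all total degrees `≤ E`. [folklore] -/
theorem succR_congr_of_le (i : Fin n) (τ : Fin n → R) {c c' : (Fin n → ℕ) → R} {E : ℕ}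
    (h : ∀ A : Fin n → ℕ, Finset.sum Finset.univ (fun j => A j) ≤ E + p →
      cleanR p n R c A = cleanR p n R c' A)
    {B : Fin n → ℕ} (hB : Finset.sum Finset.univ (fun j => B j) ≤ E) :
    succR p n R i τ c B = succR p n R i τ c' B := by
  refine succR_congr i τ B (fun A hA => h A ?_)
  have : B i ≤ Finset.sum Finset.univ (fun j => B j) :=
    Finset.single_le_sum (fun j _ => Nat.zero_le (B j)) (Finset.mem_univ i)
  omega

end Locality

/-! ## 8. Universality of `Phi`; what `(P, Q)` say about an edge -/

section System

variable {p n N N₂ ML : ℕ} {e : Fin N → (Fin n → ℕ)} {e₂ : Fin N₂ → (Fin n → ℕ)}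
  {G : Finset (MvPolynomial (Fin N ⊕ Fin ML) (ZMod p))}

variable {K : Type}

/-- The renaming `rhoX` evaluated: `(x, wx)` read off the first vertex. [folklore] -/
theorem sumElim_comp_rhoX (v v' : Fin (N + Msz n N₂ ML) → K) :
    Sum.elim v v' ∘ rhoX n N N₂ ML =
      Sum.elim (fun s => v (Fin.castAdd (Msz n N₂ ML) s))
        (fun t => v (Fin.natAdd N (wxIdx n N₂ ML t))) := by
  funext i
  cases i <;> rfl

/-- The renaming `rhoY` evaluated: `y` read off the second vertex, `wy` off the first. [folklore] -/
theorem sumElim_comp_rhoY (v v' : Fin (N + Msz n N₂ ML) → K) :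
    Sum.elim v v' ∘ rhoY n N N₂ ML =
      Sum.elim (fun s => v' (Fin.castAdd (Msz n N₂ ML) s))
        (fun t => v (Fin.natAdd N (wyIdx n N₂ ML t))) := by
  funext i
  cases i <;> rfl

variable [Field K] [Algebra (ZMod p) K]

/-- UNIVERSALITY: evaluating `Φ j s` at an edge `(v, v')` gives the coefficient at `e s` of the
successor (chart `j`, translation read off `v`) of the polynomial state recorded in `v`. [folklore] -/
theorem aeval_Phi (v v' : Fin (N + Msz n N₂ ML) → K) (j : Fin n) (s : Fin N) :
    MvPolynomial.aeval (Sum.elim v v') (Phi p n N N₂ ML e e₂ j s) =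
      succR p n K j (fun l => v (Fin.natAdd N (tauIdx n N₂ ML l)))
        (stateR n K e e₂ (fun s => v (Fin.castAdd (Msz n N₂ ML) s))
          (fun t => v (Fin.natAdd N (zIdx n N₂ ML t)))) (e s) := by
  have h := congrFun (comp_succR (p := p) (MvPolynomial.aeval (Sum.elim v v')) j
    (univTau p n N N₂ ML) (univState p n N N₂ ML e e₂)) (e s)
  rw [Function.comp_apply] at h
  rw [Phi, h, univState, comp_stateR]
  congr 1
  · funext l
    simp [univTau]
  · congr 1
    · funext s'
      simp
    · funext t
      simp

/-- What the equations `P j` say about an edge `(v, v')`. [folklore] -/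
theorem forall_Psys_iff (v v' : Fin (N + Msz n N₂ ML) → K) (j : Fin n) :
    (∀ f ∈ Psys p n N N₂ ML e e₂ G j, MvPolynomial.aeval (Sum.elim v v') f = 0) ↔
      (∀ g ∈ G, MvPolynomial.aeval (Sum.elim (fun s => v (Fin.castAdd (Msz n N₂ ML) s))
          (fun t => v (Fin.natAdd N (wxIdx n N₂ ML t)))) g = 0) ∧
      (∀ g ∈ G, MvPolynomial.aeval (Sum.elim (fun s => v' (Fin.castAdd (Msz n N₂ ML) s))
          (fun t => v (Fin.natAdd N (wyIdx n N₂ ML t)))) g = 0) ∧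
      (∀ s : Fin N, Finset.sum Finset.univ (fun j => e s j) < p →
          v (Fin.castAdd (Msz n N₂ ML) s) = 0) ∧
      (∀ s : Fin N, Finset.sum Finset.univ (fun j => e s j) < p →
          v' (Fin.castAdd (Msz n N₂ ML) s) = 0) ∧
      (∀ s : Fin N, v' (Fin.castAdd (Msz n N₂ ML) s) =
          MvPolynomial.aeval (Sum.elim v v') (Phi p n N N₂ ML e e₂ j s)) := by
  simp only [Psys, Finset.forall_mem_union, Finset.forall_mem_image, Finset.mem_filter,
    Finset.mem_univ, true_and, MvPolynomial.aeval_rename, sumElim_comp_rhoX, sumElim_comp_rhoY,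
    MvPolynomial.aeval_X, Sum.elim_inl, Sum.elim_inr, map_sub, sub_eq_zero, and_assoc,
    true_implies]

/-- What the inequations `Q j` say about an edge `(v, v')`: both jets are non-zero. [folklore] -/
theorem exists_Qsys_iff (v v' : Fin (N + Msz n N₂ ML) → K) (j : Fin n) :
    (∃ g ∈ Qsys p n N N₂ ML j, MvPolynomial.aeval (Sum.elim v v') g ≠ 0) ↔
      (∃ s : Fin N, v (Fin.castAdd (Msz n N₂ ML) s) ≠ 0) ∧
      (∃ s : Fin N, v' (Fin.castAdd (Msz n N₂ ML) s) ≠ 0) := by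
  constructor
  · rintro ⟨g, hg, hne⟩
    obtain ⟨⟨s, s'⟩, -, rfl⟩ := Finset.mem_image.1 hg
    simp only [map_mul, MvPolynomial.aeval_X, Sum.elim_inl, Sum.elim_inr, mul_ne_zero_iff] at hne
    exact ⟨⟨s, hne.1⟩, ⟨s', hne.2⟩⟩
  · rintro ⟨⟨s, hs⟩, ⟨s', hs'⟩⟩
    have hmem : ((s, s') : Fin N × Fin N) ∈ (Finset.univ ×ˢ Finset.univ : Finset (Fin N × Fin N)) :=
      Finset.mem_product.2 ⟨Finset.mem_univ _, Finset.mem_univ _⟩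
    refine ⟨_, Finset.mem_image_of_mem _ hmem, ?_⟩
    simpa only [map_mul, MvPolynomial.aeval_X, Sum.elim_inl, Sum.elim_inr] using mul_ne_zero hs hs'

end System

/-! ## 9. Jet codes, decoded states and buffered states over a field -/

section Jets

variable {p n N N₂ : ℕ} {K : Type} [Field K] {e : Fin N → (Fin n → ℕ)} {e₂ : Fin N₂ → (Fin n → ℕ)}

/-- `decode` at a recorded monomial (injective record). [folklore] -/
theorem decode_apply_e (hinj : Function.Injective e) (x : Fin N → K) (s : Fin N) :
    decode n K e x (e s) = x s := by
  unfold decode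
  have h : ∃ s', e s' = e s := ⟨s, rfl⟩
  rw [dif_pos h]
  exact congrArg x (hinj (Classical.choose_spec h))

/-- `decode` vanishes off the recorded monomials. [folklore] -/
theorem decode_eq_zero (x : Fin N → K) {A : Fin n → ℕ} (h : ¬ ∃ s, e s = A) :
    decode n K e x A = 0 := by
  unfold decode
  rw [dif_neg h]

/-- A decoded state is cleaned when no `p`-th power monomial is recorded. [folklore] -/
theorem clean_decode (he_np : ∀ s, ¬ ∀ j, p ∣ e s j) (x : Fin N → K) :
    clean p n K (decode n K e x) = decode n K e x := by
  funext A
  by_cases hA : ∀ j, p ∣ A j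
  · rw [clean_of_dvd hA]
    by_cases h : ∃ s, e s = A
    · obtain ⟨s, rfl⟩ := h
      exact absurd hA (he_np s)
    · rw [decode_eq_zero x h]
  · rw [clean_of_not_dvd hA]

/-- `code ∘ decode = id` (injective record of non-`p`-th-power monomials). [folklore] -/
theorem code_decode (hinj : Function.Injective e) (he_np : ∀ s, ¬ ∀ j, p ∣ e s j) (x : Fin N → K) :
    code p n K e (decode n K e x) = x := by
  funext s
  show clean p n K (decode n K e x) (e s) = x s
  rw [clean_decode he_np, decode_apply_e hinj]

/-- A decoded jet with no non-zero coordinate below degree `p` and some non-zero coordinate has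
multiplicity `p`. [folklore] -/
theorem multP_decode (hinj : Function.Injective e) (he_np : ∀ s, ¬ ∀ j, p ∣ e s j) {x : Fin N → K}
    (hsh : ∀ s, ∑ j, e s j < p → x s = 0) {s₀ : Fin N} (hs₀ : x s₀ ≠ 0) :
    MultP p n K (decode n K e x) := by
  unfold MultP
  rw [clean_decode he_np]
  refine ⟨⟨e s₀, by rwa [decode_apply_e hinj]⟩, fun A hA => ?_⟩
  by_contra hlt
  push Not at hlt
  by_cases h : ∃ s, e s = A
  · obtain ⟨s, rfl⟩ := h
    rw [decode_apply_e hinj] at hA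
    exact hA (hsh s hlt)
  · exact hA (decode_eq_zero x h)

/-- A buffered state at a recorded monomial of the jet block. [folklore] -/
theorem stateR_apply_e (hinj : Function.Injective e) (x : Fin N → K) (z : Fin N₂ → K) (s : Fin N) :
    stateR n K e e₂ x z (e s) = x s := by
  unfold stateR
  have h : ∃ s', e s' = e s := ⟨s, rfl⟩
  rw [dif_pos h]
  exact congrArg x (hinj (Classical.choose_spec h))

/-- Off the buffer monomials a buffered state is the decoded jet. [folklore] -/
theorem stateR_eq_decode (x : Fin N → K) (z : Fin N₂ → K) {A : Fin n → ℕ} (h : ¬ ∃ t, e₂ t = A) :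
    stateR n K e e₂ x z A = decode n K e x A := by
  unfold stateR decode
  split_ifs <;> rfl

/-- A buffered state is cleaned when no `p`-th power monomial is recorded or buffered.
[folklore] -/
theorem clean_stateR (he_np : ∀ s, ¬ ∀ j, p ∣ e s j) (he₂_np : ∀ t, ¬ ∀ j, p ∣ e₂ t j)
    (x : Fin N → K) (z : Fin N₂ → K) :
    clean p n K (stateR n K e e₂ x z) = stateR n K e e₂ x z := by
  funext A
  by_cases hA : ∀ j, p ∣ A j
  · rw [clean_of_dvd hA]
    unfold stateR
    split_ifs with h h₂
    · have hs := Classical.choose_spec h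
      rw [← hs] at hA
      exact absurd hA (he_np _)
    · have ht := Classical.choose_spec h₂
      rw [← ht] at hA
      exact absurd hA (he₂_np _)
    · rfl
  · rw [clean_of_not_dvd hA]

/-- A buffered state whose jet block has no non-zero coordinate below degree `p` and some
non-zero coordinate, and whose buffer sits in degrees `≥ p`, has multiplicity `p`. [folklore] -/
theorem multP_stateR (hinj : Function.Injective e) (he_np : ∀ s, ¬ ∀ j, p ∣ e s j)
    (he₂_np : ∀ t, ¬ ∀ j, p ∣ e₂ t j) (he₂_deg : ∀ t, p ≤ ∑ j, e₂ t j) {x : Fin N → K}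
    (z : Fin N₂ → K) (hsh : ∀ s, ∑ j, e s j < p → x s = 0) {s₀ : Fin N} (hs₀ : x s₀ ≠ 0) :
    MultP p n K (stateR n K e e₂ x z) := by
  unfold MultP
  rw [clean_stateR he_np he₂_np]
  refine ⟨⟨e s₀, by rwa [stateR_apply_e hinj]⟩, fun A hA => ?_⟩
  by_contra hlt
  push Not at hlt
  unfold stateR at hA
  split_ifs at hA with h h₂
  · have hs := Classical.choose_spec h
    apply hA (hsh _ ?_)
    rw [hs]
    exact hlt
  · have ht := he₂_deg (Classical.choose h₂)
    rw [Classical.choose_spec h₂] at ht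
    omega
  · exact hA rfl

end Jets

end ArenaProof

/-- **Anchor of part 2 of stub `stub_arena`** — `code ∘ decode = id` for an injective record of
non-`p`-th-power monomials. [folklore] -/
theorem arena_code_decode {p n N : ℕ} {K : Type} [Field K] {e : Fin N → (Fin n → ℕ)}
    (hinj : Function.Injective e) (he : ∀ s, ¬ ∀ j, p ∣ e s j) (x : Fin N → K) :
    code p n K e (decode n K e x) = x :=
  ArenaProof.code_decode hinj he x

end Summit.ResolutionOfSingularities.ResolutionOfSingularities.Theorems.FrobeniusClosing
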